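import Mathlib
import HarnessLib

/-!
# R52 instrument 3: AXIS SPEED ASYMPTOTICS — proved (sharp hypothesis `ε < γ(1−γ)`), v2 text as a corollary, v1 text refuted at `γ = 9/10`
# (nsreg-p2 `r52/Instruments52.lean` v2 ec7ee921e1367e6a / v1 664f5ed72eaf1125, `NsregP2.R52.AxisSpeedAsymptotics γ` (PROVABLE-M); seat ns-sfl-p1 g8,
# `--supports stmt-NavierStokesRegularity-19832 --as helper`)

The plane ODE of the straight-axis inflow speed, `(U − γσ)U′ = (1−γ)U − q` with forcing `|q(σ)| ≤ εσ` (`U = −u`, `q = ∂_zP` in the axis ODE):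
in the variable `v = U/σ` it reads `σv′ = −(v² − v + q/σ)/(v − γ)`.
* ★ `axisSpeedAsymptotics` — THE REPAIRED STATEMENT, PROVED: if `0 < γ < 1`, `0 ≤ ε < γ(1−γ)`, `ε < 1/8`, `U ∈ C¹`, `U(σ₀) > γσ₀` and the ODE
  with `|q| ≤ εσ` holds on `[σ₀, ∞)`, then for every `δ > 0`, eventually `|U(σ)/σ − 1| ≤ 2ε + δ`.  Proof: (1) `U > γσ` for ever (at a touching
  point the ODE forces `q = γ(1−γ)σ > εσ`); (2) fencing (`image_le_of_deriv_right_lt_deriv_boundary'`): below the level `m = 1 − 2ε − δ` the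
  drift is `v′ ≥ κ/σ` (`κ = min(γ(1−γ) − ε, δ/2)`), so `v` climbs past `m` along a logarithm and the level `m` is then a barrier; above
  `M = 1 + ε + δ` the drift is `v′ ≤ −δ/σ` and `M` is a barrier.
* `axisSpeedAsymptotics_half` — the v2 text of `NsregP2.R52.AxisSpeedAsymptotics γ` VERBATIM (`r52/Instruments52.lean` ec7ee921e1367e6a, hypothesis
  `ε < ½γ(1−γ)`), a corollary.
* ‼ `not_axisSpeedAsymptotics_nine_tenths` — THE v1 TEXT (664f5ed72eaf1125, hypothesis `ε < γ/2`; superseded) IS FALSE at `γ = 9/10`: its inner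
  `∀ ε` admits `ε = 1/10 ≥ γ(1−γ) = 9/100`, and then
  the CONSTANT speed `U ≡ 1` from `σ₀ = 1` (forcing `q ≡ 1/10`, `|q| ≤ σ/10`) solves the ODE with `U/σ → 0`.  (Kernel: `example :
  ¬ <v1 text> (9/10)`.)

HONEST FRAMING: class-free real-variable ODE facts (instruments for ROUND-52's inflow side); nothing about the crux E (19832 OPEN) or NS
regularity is proved here. [nsreg-p2 R52 instruments; folklore]
-/

noncomputable section

set_option linter.dupNamespace false

open Set Filter Topology

namespace Summit.NavierStokesRegularity.NavierStokesRegularity.Theorems.PowerGaugeEulerLiouville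

namespace ClassicalProfile

/-! ## Two elementary inequalities for the drift -/

/-- Below the level `1 − 2ε − δ` (and above `γ`) the numerator `v − v² − ε` of the drift is at least `min(γ(1−γ) − ε, δ/2)`. [folklore] -/
theorem axisSpeed_quad_lower {γ ε δ v : ℝ} (hε : 0 ≤ ε) (hδ : 0 < δ) (hv : γ < v) (hvm : v ≤ 1 - 2 * ε - δ) :
    min (γ * (1 - γ) - ε) (δ / 2) ≤ v - v ^ 2 - ε := by
  rcases le_total v (1 / 2) with h | h
  · refine (min_le_left _ _).trans ?_
    nlinarith
  · refine (min_le_right _ _).trans ?_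
    have h1 : 2 * ε + δ ≤ 1 - v := by linarith
    have h2 : 1 / 2 * (1 - v) ≤ v * (1 - v) := mul_le_mul_of_nonneg_right h (by linarith)
    nlinarith [h1, h2]

/-- Above the level `1 + ε + δ` the numerator `v² − v − ε` of the (downward) drift dominates `δ(v − γ)`. [folklore] -/
theorem axisSpeed_quad_upper {γ ε δ v : ℝ} (hγ0 : 0 < γ) (hε : 0 ≤ ε) (hδ : 0 < δ) (hv : 1 + ε + δ ≤ v) :
    δ * (v - γ) ≤ v ^ 2 - v - ε := by
  nlinarith

/-! ## The repaired statement -/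

/-- **AXIS SPEED ASYMPTOTICS** (repaired form of `NsregP2.R52.AxisSpeedAsymptotics`: the hypothesis `ε < γ/2` replaced by `ε < γ(1−γ)`):
an inflow solution `U(σ) > γσ` on `[σ₀, ∞)` of `(U − γσ)U′ = (1−γ)U − q` with `|q(σ)| ≤ εσ`, `0 ≤ ε < min(γ(1−γ), 1/8)`, satisfies
`limsup |U(σ)/σ − 1| ≤ 2ε`: for every `δ > 0`, `|U(σ)/σ − 1| ≤ 2ε + δ` for all large `σ`.  (`v = U/σ` obeys `σv′ = −(v² − v + q/σ)/(v − γ)`;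
`U > γσ` persists since at a touching point the ODE would force `q = γ(1−γ)σ > εσ`; the levels `1 − 2ε − δ` and `1 + ε + δ` are
barriers reached in finite time along logarithmic comparison curves — `image_le_of_deriv_right_lt_deriv_boundary'`.) [folklore] -/
theorem axisSpeedAsymptotics (γ : ℝ) :
    ∀ (U q : ℝ → ℝ) (σ₀ ε : ℝ), 0 < γ → γ < 1 → 0 < σ₀ → 0 ≤ ε → ε < γ * (1 - γ) → ε < 1 / 8 → ContDiff ℝ 1 U →
      γ * σ₀ < U σ₀ →
      (∀ σ, σ₀ ≤ σ → |q σ| ≤ ε * σ ∧ (U σ - γ * σ) * deriv U σ = (1 - γ) * U σ - q σ) →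
        ∀ δ : ℝ, 0 < δ → ∃ σ₁ : ℝ, ∀ σ, σ₁ ≤ σ → |U σ / σ - 1| ≤ 2 * ε + δ := by
  intro U q σ₀ ε hγ0 hγ1 hσ₀ hε hεγ _hε8 hU hU₀ hode δ hδ
  have hUc : Continuous U := hU.continuous
  have hUd : Differentiable ℝ U := hU.differentiable one_ne_zero
  -- (1) the orbit stays above `γσ`
  have hpos : ∀ x, σ₀ ≤ x → γ * x < U x := by
    intro x hx
    by_contra hle
    push Not at hle
    have hf : ContinuousOn (fun s => U s - γ * s) (Icc σ₀ x) := (hUc.sub (continuous_const.mul continuous_id)).continuousOn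
    have h0 : (0 : ℝ) ∈ Icc (U x - γ * x) (U σ₀ - γ * σ₀) := ⟨by linarith, by linarith⟩
    obtain ⟨s, hs, hs0⟩ := intermediate_value_Icc' hx hf h0
    have hs0' : U s = γ * s := by simp only at hs0; linarith
    obtain ⟨hq, hO⟩ := hode s hs.1
    rw [hs0', sub_self, zero_mul] at hO
    have hqs : q s = (1 - γ) * (γ * s) := by linarith
    have hs_pos : 0 < s := hσ₀.trans_le hs.1
    have h1 : |q s| = (1 - γ) * (γ * s) := by rw [hqs]; exact abs_of_pos (by nlinarith)
    have h2 : ε * s < γ * (1 - γ) * s := mul_lt_mul_of_pos_right hεγ hs_pos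
    linarith [hq]
  -- the speed ratio `v = U/σ` and its derivative
  set v : ℝ → ℝ := fun x => U x / x with hvdef
  set v' : ℝ → ℝ := fun x => (deriv U x * x - U x) / x ^ 2 with hv'def
  have hv : ∀ x, 0 < x → HasDerivAt v (v' x) x := by
    intro x hx
    have h := ((hUd x).hasDerivAt).div (hasDerivAt_id x) hx.ne'
    simp only [id, mul_one] at h
    exact h
  have hvc : ∀ a b, σ₀ ≤ a → ContinuousOn v (Icc a b) := fun a b ha x hx =>
    (hv x (hσ₀.trans_le (ha.trans hx.1))).continuousAt.continuousWithinAt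
  have hvw : ∀ a b, σ₀ ≤ a → ∀ x ∈ Ico a b, HasDerivWithinAt v (v' x) (Ici x) x := fun a b ha x hx =>
    (hv x (hσ₀.trans_le (ha.trans hx.1))).hasDerivWithinAt
  have hvγ : ∀ x, σ₀ ≤ x → γ < v x := by
    intro x hx
    have hx0 : 0 < x := hσ₀.trans_le hx
    simp only [hvdef]
    rw [lt_div_iff₀ hx0]
    exact hpos x hx
  -- the drift: `v' = (xU − U² − xq)/((U − γx)x²)`, squeezed by `q ∈ [−εx, εx]`
  have hv'eq : ∀ x, σ₀ ≤ x → v' x = (x * U x - U x ^ 2 - x * q x) / ((U x - γ * x) * x ^ 2) := by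
    intro x hx
    have hx0 : 0 < x := hσ₀.trans_le hx
    have hD : 0 < U x - γ * x := by linarith [hpos x hx]
    have hO := (hode x hx).2
    have hU' : deriv U x = ((1 - γ) * U x - q x) / (U x - γ * x) := by
      rw [eq_div_iff hD.ne', mul_comm]; exact hO
    simp only [hv'def]
    rw [hU', div_eq_div_iff (pow_ne_zero 2 hx0.ne') (mul_ne_zero hD.ne' (pow_ne_zero 2 hx0.ne'))]
    field_simp
    ring
  have hv'low : ∀ x, σ₀ ≤ x → (x * U x - U x ^ 2 - ε * x ^ 2) / ((U x - γ * x) * x ^ 2) ≤ v' x := by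
    intro x hx
    have hx0 : 0 < x := hσ₀.trans_le hx
    have hD : 0 < U x - γ * x := by linarith [hpos x hx]
    rw [hv'eq x hx]
    refine div_le_div_of_nonneg_right ?_ (by positivity)
    nlinarith [(abs_le.1 (hode x hx).1).2]
  have hv'up : ∀ x, σ₀ ≤ x → v' x ≤ (x * U x - U x ^ 2 + ε * x ^ 2) / ((U x - γ * x) * x ^ 2) := by
    intro x hx
    have hx0 : 0 < x := hσ₀.trans_le hx
    have hD : 0 < U x - γ * x := by linarith [hpos x hx]
    rw [hv'eq x hx]
    refine div_le_div_of_nonneg_right ?_ (by positivity)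
    nlinarith [(abs_le.1 (hode x hx).1).1]
  -- the two levels
  set m : ℝ := 1 - 2 * ε - δ with hmdef
  set M : ℝ := 1 + ε + δ with hMdef
  set κ : ℝ := min (γ * (1 - γ) - ε) (δ / 2) with hκdef
  have hκ : 0 < κ := lt_min (by linarith) (by linarith)
  -- LOWER DRIFT: below `m` (and above `γ`), `v' ≥ κ / (U − γx) > (κ/2) / x`
  have hlow : ∀ x, σ₀ ≤ x → v x ≤ m → κ / (U x - γ * x) ≤ v' x := by
    intro x hx hxm
    have hx0 : 0 < x := hσ₀.trans_le hx
    have hD : 0 < U x - γ * x := by linarith [hpos x hx]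
    refine le_trans ?_ (hv'low x hx)
    rw [div_le_div_iff₀ hD (by positivity)]
    have hq := axisSpeed_quad_lower (γ := γ) hε hδ (hvγ x hx) hxm
    have hvx : v x = U x / x := rfl
    rw [hvx] at hq
    have h1 : κ * x ^ 2 ≤ x * U x - U x ^ 2 - ε * x ^ 2 := by
      have h2 : (U x / x - (U x / x) ^ 2 - ε) * x ^ 2 = x * U x - U x ^ 2 - ε * x ^ 2 := by
        field_simp
      rw [← h2]
      exact mul_le_mul_of_nonneg_right hq (by positivity)
    nlinarith [h1, hD]
  have hlow' : ∀ x, σ₀ ≤ x → v x ≤ m → κ / 2 / x < v' x := by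
    intro x hx hxm
    have hx0 : 0 < x := hσ₀.trans_le hx
    have hD : 0 < U x - γ * x := by linarith [hpos x hx]
    refine lt_of_lt_of_le ?_ (hlow x hx hxm)
    have hDx : U x - γ * x < 2 * x := by
      have hvx : v x = U x / x := rfl
      have h1 : U x / x ≤ m := hxm
      rw [div_le_iff₀ hx0] at h1
      have hm1 : m ≤ 1 := by simp only [hmdef]; linarith
      nlinarith
    rw [div_lt_div_iff₀ hx0 hD]
    nlinarith
  -- UPPER DRIFT: above `M`, `v' ≤ −δ / x`
  have hup : ∀ x, σ₀ ≤ x → M ≤ v x → v' x ≤ -δ / x := by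
    intro x hx hxM
    have hx0 : 0 < x := hσ₀.trans_le hx
    have hD : 0 < U x - γ * x := by linarith [hpos x hx]
    refine (hv'up x hx).trans ?_
    rw [div_le_div_iff₀ (by positivity) hx0]
    have hq := axisSpeed_quad_upper (γ := γ) hγ0 hε hδ hxM
    have hvx : v x = U x / x := rfl
    rw [hvx] at hq
    have h2 : (δ * (U x / x - γ)) * x ^ 2 = δ * x * (U x - γ * x) := by
      field_simp
    have h3 : ((U x / x) ^ 2 - U x / x - ε) * x ^ 2 = -(x * U x - U x ^ 2 + ε * x ^ 2) := by
      field_simp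
      ring
    have h4 : δ * x * (U x - γ * x) ≤ -(x * U x - U x ^ 2 + ε * x ^ 2) := by
      rw [← h2, ← h3]
      exact mul_le_mul_of_nonneg_right hq (by positivity)
    nlinarith [h4]
  -- LOWER BARRIER: once `v ≥ m`, for ever `v ≥ m`
  have hbarL : ∀ a, σ₀ ≤ a → m ≤ v a → ∀ x, a ≤ x → m ≤ v x := by
    intro a ha hma x hax
    have key := image_le_of_deriv_right_lt_deriv_boundary' (f := fun _ => m) (f' := fun _ => 0) (a := a) (b := x)
      continuousOn_const (fun y _ => (hasDerivAt_const y m).hasDerivWithinAt) (B := v) (B' := v') hma (hvc a x ha)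
      (hvw a x ha) (fun y hy hym => ?_)
    · exact key (right_mem_Icc.2 hax)
    · have hy : σ₀ ≤ y := ha.trans hy.1
      have hy0 : 0 < y := hσ₀.trans_le hy
      have hD : 0 < U y - γ * y := by linarith [hpos y hy]
      exact lt_of_lt_of_le (by positivity) (hlow y hy hym.symm.le)
  -- UPPER BARRIER: once `v ≤ M`, for ever `v ≤ M`
  have hbarU : ∀ a, σ₀ ≤ a → v a ≤ M → ∀ x, a ≤ x → v x ≤ M := by
    intro a ha haM x hax
    have key := image_le_of_deriv_right_lt_deriv_boundary' (f := v) (f' := v') (a := a) (b := x) (hvc a x ha)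
      (hvw a x ha) (B := fun _ => M) (B' := fun _ => 0) haM continuousOn_const
      (fun y _ => (hasDerivAt_const y M).hasDerivWithinAt) (fun y hy hyM => ?_)
    · exact key (right_mem_Icc.2 hax)
    · have hy : σ₀ ≤ y := ha.trans hy.1
      have hy0 : 0 < y := hσ₀.trans_le hy
      exact lt_of_le_of_lt (hup y hy hyM.symm.le) (by rw [neg_div]; exact neg_lt_zero.2 (by positivity))
  -- LOWER ARRIVAL: from any `a ≥ σ₀` the orbit reaches the level `m`
  have harrL : ∀ a, σ₀ ≤ a → ∃ b, a ≤ b ∧ m ≤ v b := by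
    intro a ha
    by_contra hcon
    push Not at hcon
    have ha0 : 0 < a := hσ₀.trans_le ha
    set c : ℝ := κ / 2 with hcdef
    have hc : 0 < c := by positivity
    have hma : v a < m := hcon a le_rfl
    set b : ℝ := a * Real.exp ((m - v a) / c + 1) with hbdef
    have hab : a ≤ b := by
      have h1 : (1 : ℝ) ≤ Real.exp ((m - v a) / c + 1) := Real.one_le_exp (by positivity)
      simpa [hbdef] using (le_mul_of_one_le_right ha0.le h1)
    set B : ℝ → ℝ := fun y => v a + c * (Real.log y - Real.log a) with hBdef
    have hBc : ContinuousOn B (Icc a b) := fun y hy =>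
      (continuousAt_const.add (continuousAt_const.mul
        ((Real.continuousAt_log (ha0.trans_le hy.1).ne').sub continuousAt_const))).continuousWithinAt
    have hBd : ∀ y ∈ Ico a b, HasDerivWithinAt B (c / y) (Ici y) y := by
      intro y hy
      have hy0 : 0 < y := ha0.trans_le hy.1
      have h := (((Real.hasDerivAt_log hy0.ne').sub_const (Real.log a)).const_mul c).const_add (v a)
      rw [show c * y⁻¹ = c / y by rw [div_eq_mul_inv]] at h
      exact h.hasDerivWithinAt
    have key := image_le_of_deriv_right_lt_deriv_boundary' (f := B) (f' := fun y => c / y) (a := a) (b := b) hBc hBd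
      (B := v) (B' := v') (by simp [hBdef]) (hvc a b ha) (hvw a b ha) (fun y hy _ => ?_)
    · have hBb : B b = m + c := by
        simp only [hBdef, hbdef]
        rw [Real.log_mul ha0.ne' (Real.exp_pos _).ne', Real.log_exp]
        field_simp
        ring
      have h1 := key (right_mem_Icc.2 hab)
      have h2 := hcon b hab
      rw [hBb] at h1
      linarith
    · have hy' : σ₀ ≤ y := ha.trans hy.1
      have hym : v y ≤ m := (hcon y hy.1).le
      exact hlow' y hy' hym
  -- UPPER ARRIVAL: from any `a ≥ σ₀` the orbit reaches the level `M`
  have harrU : ∀ a, σ₀ ≤ a → ∃ b, a ≤ b ∧ v b ≤ M := by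
    intro a ha
    by_contra hcon
    push Not at hcon
    have ha0 : 0 < a := hσ₀.trans_le ha
    set c : ℝ := δ / 2 with hcdef
    have hc : 0 < c := by positivity
    have hMa : M < v a := hcon a le_rfl
    set b : ℝ := a * Real.exp ((v a - M) / c + 1) with hbdef
    have hab : a ≤ b := by
      have h1 : (1 : ℝ) ≤ Real.exp ((v a - M) / c + 1) := Real.one_le_exp (by
        have : 0 ≤ (v a - M) / c := div_nonneg (by linarith) hc.le
        linarith)
      simpa [hbdef] using (le_mul_of_one_le_right ha0.le h1)
    set B : ℝ → ℝ := fun y => v a - c * (Real.log y - Real.log a) with hBdef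
    have hBc : ContinuousOn B (Icc a b) := fun y hy =>
      (continuousAt_const.sub (continuousAt_const.mul
        ((Real.continuousAt_log (ha0.trans_le hy.1).ne').sub continuousAt_const))).continuousWithinAt
    have hBd : ∀ y ∈ Ico a b, HasDerivWithinAt B (-(c / y)) (Ici y) y := by
      intro y hy
      have hy0 : 0 < y := ha0.trans_le hy.1
      have h := (((Real.hasDerivAt_log hy0.ne').sub_const (Real.log a)).const_mul c).const_sub (v a)
      rw [show -(c * y⁻¹) = -(c / y) by rw [div_eq_mul_inv]] at h
      exact h.hasDerivWithinAt
    have key := image_le_of_deriv_right_lt_deriv_boundary' (f := v) (f' := v') (a := a) (b := b) (hvc a b ha) (hvw a b ha)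
      (B := B) (B' := fun y => -(c / y)) (by simp [hBdef]) hBc hBd (fun y hy _ => ?_)
    · have hBb : B b = M - c := by
        simp only [hBdef, hbdef]
        rw [Real.log_mul ha0.ne' (Real.exp_pos _).ne', Real.log_exp]
        field_simp
        ring
      have h1 := key (right_mem_Icc.2 hab)
      have h2 := hcon b hab
      rw [hBb] at h1
      linarith
    · have hy' : σ₀ ≤ y := ha.trans hy.1
      have hy0 : 0 < y := ha0.trans_le hy.1
      have hyM : M ≤ v y := (hcon y hy.1).le
      refine lt_of_le_of_lt (hup y hy' hyM) ?_
      rw [neg_div, neg_lt_neg_iff, div_lt_div_iff_of_pos_right hy0]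
      simp only [hcdef]
      linarith
  -- ASSEMBLY
  obtain ⟨b₁, hb₁, hmb₁⟩ := harrL σ₀ le_rfl
  obtain ⟨b₂, hb₂, hMb₂⟩ := harrU σ₀ le_rfl
  refine ⟨max b₁ b₂, fun σ hσ => ?_⟩
  have h1 : m ≤ v σ := hbarL b₁ hb₁ hmb₁ σ ((le_max_left _ _).trans hσ)
  have h2 : v σ ≤ M := hbarU b₂ hb₂ hMb₂ σ ((le_max_right _ _).trans hσ)
  have hvσ : v σ = U σ / σ := rfl
  rw [← hvσ, abs_le]
  simp only [hmdef] at h1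
  simp only [hMdef] at h2
  constructor <;> linarith

/-- **`NsregP2.R52.AxisSpeedAsymptotics γ`, v2 text VERBATIM** (nsreg-p2 `r52/Instruments52.lean` ec7ee921e1367e6a, hypothesis
`ε < ½γ(1−γ)`): a corollary of `axisSpeedAsymptotics` (`½γ(1−γ) < γ(1−γ)` for `0 < γ < 1`). [nsreg-p2 R52 instrument 3; folklore] -/
theorem axisSpeedAsymptotics_half (γ : ℝ) :
    ∀ (U q : ℝ → ℝ) (σ₀ ε : ℝ), 0 < γ → γ < 1 → 0 < σ₀ → 0 ≤ ε → ε < γ * (1 - γ) / 2 → ε < 1 / 8 → ContDiff ℝ 1 U →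
      γ * σ₀ < U σ₀ →
      (∀ σ, σ₀ ≤ σ → |q σ| ≤ ε * σ ∧ (U σ - γ * σ) * deriv U σ = (1 - γ) * U σ - q σ) →
        ∀ δ : ℝ, 0 < δ → ∃ σ₁ : ℝ, ∀ σ, σ₁ ≤ σ → |U σ / σ - 1| ≤ 2 * ε + δ := by
  intro U q σ₀ ε hγ0 hγ1 hσ₀ hε hεγ hε8 hU hU₀ hode
  refine axisSpeedAsymptotics γ U q σ₀ ε hγ0 hγ1 hσ₀ hε ?_ hε8 hU hU₀ hode
  nlinarith

/-! ## The text as typed is false at `γ = 9/10` -/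

/-- **REFUTATION OF THE v1 TEXT** of `NsregP2.R52.AxisSpeedAsymptotics (9/10)` (`r52/Instruments52.lean` v1 664f5ed72eaf1125, hypothesis `ε < γ/2`,
unfolded verbatim; superseded by v2's `ε < ½γ(1−γ)`): with `γ = 9/10` the inner `∀ ε` admits
`ε = 1/10` (`< γ/2`, `< 1/8`, but `≥ γ(1−γ) = 9/100`), and the CONSTANT speed `U ≡ 1` from `σ₀ = 1` with forcing `q ≡ 1/10` (`|q σ| ≤ σ/10` for
`σ ≥ 1`) solves `(U − γσ)U′ = (1−γ)U − q` (`0 = 1/10 − 1/10`) while `U(σ)/σ = 1/σ → 0`, so `|U/σ − 1| ≤ 2ε + δ = 1/5 + δ` fails for `δ = 1/10`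
at every `σ ≥ 10`.  The repair is `ε < γ(1−γ)`, see `axisSpeedAsymptotics`. [folklore] -/
theorem not_axisSpeedAsymptotics_nine_tenths :
    ¬ (∀ (U q : ℝ → ℝ) (σ₀ ε : ℝ), 0 < (9 / 10 : ℝ) → (9 / 10 : ℝ) < 1 → 0 < σ₀ → 0 ≤ ε → ε < (9 / 10 : ℝ) / 2 → ε < 1 / 8 →
      ContDiff ℝ 1 U → (9 / 10 : ℝ) * σ₀ < U σ₀ →
      (∀ σ, σ₀ ≤ σ → |q σ| ≤ ε * σ ∧ (U σ - (9 / 10 : ℝ) * σ) * deriv U σ = (1 - (9 / 10 : ℝ)) * U σ - q σ) →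
        ∀ δ : ℝ, 0 < δ → ∃ σ₁ : ℝ, ∀ σ, σ₁ ≤ σ → |U σ / σ - 1| ≤ 2 * ε + δ) := by
  intro h
  have h1 := h (fun _ => 1) (fun _ => 1 / 10) 1 (1 / 10) (by norm_num) (by norm_num) (by norm_num) (by norm_num) (by norm_num)
    (by norm_num) contDiff_const (by norm_num) (fun σ hσ => ⟨?_, ?_⟩) (1 / 10) (by norm_num)
  · obtain ⟨σ₁, hσ₁⟩ := h1
    have h2 := hσ₁ (max σ₁ 10) (le_max_left _ _)
    have h10 : (10 : ℝ) ≤ max σ₁ 10 := le_max_right _ _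
    have hpos : (0 : ℝ) < max σ₁ 10 := by linarith
    have h3 : (1 : ℝ) / max σ₁ 10 ≤ 1 / 10 := by
      rw [div_le_div_iff_of_pos_left one_pos hpos (by norm_num)]; exact h10
    have h4 : |(1 : ℝ) / max σ₁ 10 - 1| = 1 - 1 / max σ₁ 10 := by
      rw [abs_sub_comm]; exact abs_of_nonneg (by linarith)
    rw [h4] at h2
    linarith
  · rw [abs_of_pos (by norm_num)]
    linarith
  · simp only [deriv_const', mul_zero]
    norm_num

end ClassicalProfile

end Summit.NavierStokesRegularity.NavierStokesRegularity.Theorems.PowerGaugeEulerLiouville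

end
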